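import Summits.QuantumFields.YangMills.Theorems.BalabanUVNodesN15PerCubeGreenTwoGridKnitDefectReg335Letters
import Literature.MathematicalPhysics.QuantumFieldTheory.Balaban1983to89.B7Prop10InLambdaRec
import HarnessLib

/-!
# N15 = NE2, road (c) — PROGRAMME (PC) «[B9] Sect. C FOR THE LANDAU LETTER WITH PER-CUBE GAUGES (3.35) AS PRINTED», (PC-E) (C6-e) (G6): THE SMALL-DATA FORM — the two-grid η-defect of
# the glued scalar covariant Green's functions from ONE (3.35) datum per cube is `≤ D′·(L^{−k∕4} + o_B)·e^{−(δ∕16)dist}` as soon as `(1 + κ_e2√|m|·√|m|)²·(C∕ξ + C∕ξ²) ≤ c₀`: every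
# auxiliary letter and every numeric threshold of n15-c∕340∕353∕354 ELIMINATED by elementary estimates (B7 port `(1+a)^N − 1 ≤ 2Na`, `|a_{r+k} − a_k| ≤ 2a₀L^{−2k}`, `L^{−k}, L^{−2k} ≤ L^{−k∕4}`)
# (dag-n15-c g32, n15-c∕355)

Cell `pub-ymgap`, seat `pub-ymgap-dag-n15-c` (generation g32; R134 (a) seat, strategy s1 «first missing estimate»; HUMAN RULING D-0062; chair R424 venue).
`bears_on: R4∕N15 · K3⁸ SpineGivenEndpointR13SepCoPHV (stmt-QuantumFields-27366)`; filed `--kind proof --supports stmt-QuantumFields-27366 --as helper` — COUNT-NEUTRAL; THEOREMS only, 0 `def`, 0 `sorry`.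

WHAT IT SAYS.  ★★★ `uN_idef_scGreen_tr_of_reg335_small`: there are `δ, c₀ > 0`, `w₀`, `D′` (depending on `d`, `L`, `a₀`, `ι` only) such that for all scales `k ≥ 1`, `r ≥ 1`, `L^{m_v} ≥ w₀`,
every colour space `mm` with trace-form coordinates `e`, every unitary-group valued fine bond field `U′` carrying ONE `Reg335Cube` datum (constants `ξ, C`) per cube of the cover on a site
set containing the five-block collar of the cube's plateau, with `(1 + κ_e2√|m|√|m|)²(C∕ξ + C∕ξ²) ≤ c₀`: cube gauges `u′_k` exist (unitary) such that, GIVEN the displayed componentwise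
divergence fit `o_B ≥ 0` (n15-c∕344's `hB`), the two-grid η-defect of the glued scalar covariant Green's functions (fine `G′(U′)` in the gauges `u′_k` against coarse `G′(U)`, `U` = the
straight fine holonomy, in the induced gauges `u′_k∘σ`) through the covariant transport obeys `D′·(L^{−k∕4} + o_B)·e^{−(δ∕16)dist}`.

HONEST FRAMING ∕ LIMITS.  Elementary bookkeeping; MODEL two-grid setting (coarse field = straight fine holonomy; (3.35) as the typed SHAPE `Reg335Cube`); `o_B` stays displayed — LOCATED beyond
print (needs all second differences `|∇^η∇^ηA| ≲ Cξ⁻³` of the cube gauge field; [B9] (3.36) p.396 prints `|∂^{η*}∂^ηA|` only).  NE2⁺ NOT PRINTED, NOT proved; N15 of record untouched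
(DISCHARGED AS CONSUMED, p687738); K3⁸ OPEN; counts of record UNMOVED (typed 28∕28 · discharged 8∕27); one finite 𝕋⁴ at fixed ε per index — NOT infinite volume, NOT OS on ℝ⁴, NOT a mass
gap, NOT Clay.  Restate-immune (no Theses import).
-/

set_option autoImplicit false

noncomputable section

open scoped BigOperators Matrix Matrix.Norms.L2Operator
open Finset

namespace Summit.QuantumFields.YangMills.BalabanUVNodes.N15.Gluing

open Real
open Literature.MathematicalPhysics.QuantumFieldTheory.Balaban1983to89
open Literature.MathematicalPhysics.QuantumFieldTheory.Balaban1983to89.B5Prop11Plancherel (Tor fine unitVec)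
open Literature.MathematicalPhysics.QuantumFieldTheory.Balaban1983to89.B11SectG (BlockNorm HasMaj)
open Literature.MathematicalPhysics.QuantumFieldTheory.Balaban1983to89.T4EtaRateDefect (idef)
open Literature.MathematicalPhysics.QuantumFieldTheory.Balaban1983to89.B6UnitTorusCarrier (unitTorusGeo)
open Literature.MathematicalPhysics.QuantumFieldTheory.Balaban1983to89.B9Eq335RegularityClasses (Reg335Cube)
open Literature.MathematicalPhysics.QuantumFieldTheory.King1986 (aK aK_pos aK_le)
open Literature.MathematicalPhysics.QuantumFieldTheory.Balaban1983to89.B7Prop10InLambdaRec (one_add_pow_sub_one_le)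
open Literature.Barriers.QuantumFields (traceForm)
open Summit.QuantumFields.YangMills.BalabanUVNodes.N15.BackgroundLayer (tCoefA tCoefC)
open Summit.QuantumFields.YangMills.BalabanUVNodes.N15.VectorPiece (kingPr)
open Summit.QuantumFields.YangMills.BalabanUVNodes.N15.MatrixSpecies (coordMat basisConst basisConst_nonneg liftBlk liftMap)
open Summit.QuantumFields.YangMills.BalabanUVNodes.N15.CurvedSpecies (gaugePair)
open Summit.QuantumFields.YangMills.BalabanUVNodes.N15.CovAvg (mprod kingSec ctauS)

variable {d : ℕ}

/-! ## §1 Two elementary estimates -/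

/-- ★ King's constants at two levels: `|a_{r+k} − a_k| ≤ 2a·L^{−2k}` for `a > 0`, `L ≥ 2`, `k ≥ 1` (`a_j = a(1 − L⁻²)∕(1 − L^{−2j})`). [cite: King1986, p.664 (the constants a_k: shape)] -/
theorem abs_aK_sub_aK_le {a L : ℝ} (ha : 0 < a) (hL : 2 ≤ L) {k : ℕ} (hk : 1 ≤ k) (r : ℕ) :
    |aK a L (r + k) - aK a L k| ≤ 2 * a * (L ^ (2 * k))⁻¹ := by
  have hL1 : (1 : ℝ) < L := by linarith
  have hL0 : (0 : ℝ) < L := by linarith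
  set u : ℝ := (L ^ (2 * k))⁻¹ with hu
  set v : ℝ := (L ^ (2 * (r + k)))⁻¹ with hv
  have hu0 : 0 < u := by positivity
  have hv0 : 0 < v := by positivity
  have hL2k : (4 : ℝ) ≤ L ^ (2 * k) := by
    calc (4 : ℝ) = 2 ^ 2 := by norm_num
      _ ≤ L ^ 2 := pow_le_pow_left₀ (by norm_num) hL 2
      _ ≤ L ^ (2 * k) := pow_le_pow_right₀ hL1.le (by omega)
  have hu4 : u ≤ 1 / 4 := by rw [hu, inv_eq_one_div]; exact one_div_le_one_div_of_le (by norm_num) hL2k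
  have hvu : v ≤ u := by
    rw [hu, hv]; exact inv_anti₀ (by positivity) (pow_le_pow_right₀ hL1.le (by omega))
  have hc0 : 0 < 1 - (L ^ 2)⁻¹ := by
    have : (L ^ 2)⁻¹ < 1 := inv_lt_one_of_one_lt₀ (by nlinarith)
    linarith
  have hc1 : 1 - (L ^ 2)⁻¹ ≤ 1 := by
    have : 0 ≤ (L ^ 2)⁻¹ := by positivity
    linarith
  have e1 : aK a L k = a * (1 - (L ^ 2)⁻¹) / (1 - u) := rfl
  have e2 : aK a L (r + k) = a * (1 - (L ^ 2)⁻¹) / (1 - v) := rfl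
  rw [e1, e2]
  have h1u : 0 < 1 - u := by linarith
  have h1v : 0 < 1 - v := by linarith
  have hdiff : a * (1 - (L ^ 2)⁻¹) / (1 - v) - a * (1 - (L ^ 2)⁻¹) / (1 - u) = -(a * (1 - (L ^ 2)⁻¹) * (u - v) / ((1 - u) * (1 - v))) := by
    field_simp; ring
  have huv : 0 ≤ u - v := by linarith
  rw [hdiff, abs_neg, abs_of_nonneg (by positivity)]
  rw [div_le_iff₀ (mul_pos h1u h1v)]
  have h34 : (3 / 4 : ℝ) * (3 / 4) ≤ (1 - u) * (1 - v) := mul_le_mul (by linarith) (by linarith) (by norm_num) h1u.le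
  nlinarith [mul_nonneg ha.le hu0.le, mul_nonneg (mul_nonneg ha.le hc0.le) hv0.le]

/-- `x⁻¹ ≤ x^{−1∕4}` and `(x²)⁻¹ ≤ x^{−1∕4}` for `x ≥ 1`. [folklore] -/
theorem inv_le_rpow_neg_quarter {x : ℝ} (hx : 1 ≤ x) : x⁻¹ ≤ x ^ (-(1 / 4 : ℝ)) ∧ (x ^ 2)⁻¹ ≤ x ^ (-(1 / 4 : ℝ)) := by
  have hx0 : 0 < x := by linarith
  refine ⟨?_, ?_⟩
  · rw [← Real.rpow_neg_one]
    exact Real.rpow_le_rpow_of_exponent_le hx (by norm_num)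
  · rw [← Real.rpow_natCast, ← Real.rpow_neg hx0.le]
    exact Real.rpow_le_rpow_of_exponent_le hx (by norm_num)

/-! ## §2 The bookkeeping of the letters (pure real arithmetic) -/
set_option maxHeartbeats 1600000 in
/-- ★★ **THE BOOKKEEPING OF THE LETTERS** (pure real arithmetic; every hypothesis is a definition or an elementary fact of the closing assembly's letters): under
`(1 + κ√|m|)²(t + t₂) ≤ c₀` with the constants `K₁ K₂ c₀ K_I A B K_B` as chosen in the sequel, (i) n15-c∕340's threshold `hRle` holds at the chosen `r_V`, and (ii) the rate
`D·(L^{−k∕4} + o + E₄)` is `≤ max(D,0)·(1 + A + B + K_B)·(L^{−k∕4} + o_B)`. [folklore] -/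
theorem letters_bookkeeping
    (I dd dd1 J JJ nr Lk Lr Lrm η' η κ sm t t₂ pf qf Ep P Qq P1 Q1 EP PC E3 X INNER TA TC KTH aKk aKrk ON RV E1 E2 E4 x14 L2inv oB a₀ R₀ K₁ K₂ c₀ KI Aη Bc KB D ex : ℝ)
    (Nr M1 M2 M4 : ℕ)
    (hI0 : 0 ≤ I) (hdd0 : 0 ≤ dd) (hdd1 : dd1 = dd + 1) (hJ : J = dd + 1) (hJJ : JJ = 2 * (dd + 1)) (ha₀ : 0 < a₀)
    (hK₁ : K₁ = I * (6 + (dd + 1) * (36 * I + 6))) (hK₂ : K₂ = (1 + 2 * (dd + 1)) + 2 * a₀ * I * (4 * (dd + 1) ^ 2 * I + 4 * (dd + 1)))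
    (hc₀pos : 0 < c₀) (hc₀a : c₀ ≤ 1 / (100 * (dd + 1) * (I + 1) * (K₁ + 1))) (hc₀b : c₀ ≤ R₀ / (K₁ * K₂ + 1))
    (hKI : KI = (3 * (dd + 2) + 72 * I) * c₀)
    (hAη : Aη = (I * KI + I ^ 2 * (dd + 1) * KI) * (1 + 2 * (dd + 1)) + 2 * a₀ * I ^ 2 * ((dd + 1) * (3 * dd + 6) * c₀) + 12 * (dd + 1) * I * c₀)
    (hBc : Bc = 2 * a₀ * I * (1 + I)) (hKB : KB = I * (dd + 1) * (1 + 2 * (dd + 1)))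
    (hLk1 : 1 ≤ Lk) (hLr1 : 1 ≤ Lr) (hnrdef : nr = Lr * Lk) (hLrmdef : Lrm = Lr - 1) (hηqdef : η' = nr⁻¹) (hηdef : η = Lk⁻¹)
    (hNr : (Nr : ℝ) = Lr) (hM1 : (M1 : ℝ) = (dd + 1) * Lk) (hM2 : (M2 : ℝ) = (dd + 1) * nr) (hM4 : (M4 : ℝ) = (dd + 1) * Lrm)
    (hκ : 0 ≤ κ) (hsm : 0 ≤ sm) (ht0 : 0 ≤ t) (ht₂0 : 0 ≤ t₂) (hsmall : (1 + κ * sm) ^ 2 * (t + t₂) ≤ c₀)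
    (hpfdef : pf = t * Real.exp (η' * t)) (hqfdef : qf = t₂ * Real.exp (η' * t))
    (hEpdef : Ep = (1 + η' * pf) ^ Nr - 1) (hPdef : P = Ep / η) (hQqdef : Qq = qf * (1 + η' * pf) ^ Nr)
    (hP1def : P1 = κ * (sm * P)) (hQ1def : Q1 = κ * (sm * Qq)) (hEPdef : EP = (1 + η' * P) ^ Nr - 1) (hPCdef : PC = Lk * (κ * (sm * EP)))
    (hE3def : E3 = (1 + I * (η' * P1)) ^ Nr - 1) (hXdef : X = dd1 * Lrm + Lr + 1)
    (hINNERdef : INNER = nr * (κ * (sm * (X * (η' ^ 2 * qf))) + E3 * (η' * P1))) (hTAdef : TA = I * INNER) (hTCdef : TC = I * (J * (oB + I * (INNER * (P1 + PC)))))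
    (hKTHdef : KTH = κ * (sm * ((dd + 1) * (dd * (nr * (Lr * (η' ^ 2 * qf))) + Ep))))
    (haK : |aKk| ≤ a₀) (hΔaK : |aKrk - aKk| ≤ 2 * a₀ * L2inv)
    (hONdef : ON = I * (|aKrk - aKk| * (1 + I) + |aKk| * (2 * I * KTH)))
    (hRVdef : RV = I * P1 + I * (J * (I * P1 ^ 2 + Q1))) (hE1def : E1 = (1 + RV * η) ^ M1 - 1) (hE2def : E2 = (1 + RV * η') ^ M2 - 1)
    (hE4def : E4 = (1 + (I * (η' * P1))) ^ M4 - 1) (hx0 : 0 ≤ x14) (hηx : η ≤ x14) (hL2x : L2inv ≤ x14) (hoB : 0 ≤ oB) (hex : 0 < ex) :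
    RV * (1 + JJ) + (a₀ * (I * (I * E1 ^ 2 + 2 * E1)) + a₀ * (I * (I * E2 ^ 2 + 2 * E2))) ≤ R₀ ∧
      D * (x14 + ((TA + TC) * (1 + JJ) + ON + E4)) * ex ≤ max D 0 * (1 + Aη + Bc + KB) * (x14 + oB) * ex := by
  obtain ⟨hK₁0, hK₂0, hKI0⟩ : 0 ≤ K₁ ∧ 0 ≤ K₂ ∧ 0 ≤ KI := ⟨by rw [hK₁]; positivity, by rw [hK₂]; positivity, by rw [hKI]; positivity⟩
  obtain ⟨hAη0, hBc0, hKB0⟩ : 0 ≤ Aη ∧ 0 ≤ Bc ∧ 0 ≤ KB := ⟨by rw [hAη]; positivity, by rw [hBc]; positivity, by rw [hKB]; positivity⟩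
  have hdd1p : (0 : ℝ) ≤ dd + 1 := by linarith only [hdd0]
  have hI1p : (0 : ℝ) ≤ I + 1 := by linarith only [hI0]
  have hIc : 100 * ((dd + 1) * ((I + 1) * ((K₁ + 1) * c₀))) ≤ 1 := by
    have h := hc₀a; rw [le_div_iff₀ (by positivity)] at h; linarith only [h]
  have hc₀1 : c₀ ≤ 1 / 100 := by
    have h2 : (1 : ℝ) * c₀ ≤ ((dd + 1) * ((I + 1) * (K₁ + 1))) * c₀ :=
      mul_le_mul_of_nonneg_right (by nlinarith only [hdd0, hI0, hK₁0, mul_nonneg hdd0 hI0, mul_nonneg (mul_nonneg hdd0 hI0) hK₁0, mul_nonneg hdd0 hK₁0, mul_nonneg hI0 hK₁0]) hc₀pos.le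
    linarith only [h2, hIc]
  set S : ℝ := κ * sm with hSdef
  have hS0 : 0 ≤ S := by positivity
  have hsq : (1 : ℝ) ≤ (1 + S) ^ 2 := by nlinarith only [hS0, sq_nonneg S]
  have hsum : t + t₂ ≤ c₀ := by linarith only [hsmall, mul_le_mul_of_nonneg_right hsq (add_nonneg ht0 ht₂0)]
  obtain ⟨htc, ht₂c⟩ : t ≤ c₀ ∧ t₂ ≤ c₀ := ⟨by linarith only [hsum, ht₂0], by linarith only [hsum, ht0]⟩
  obtain ⟨hSsq, hS2sq⟩ : S ≤ (1 + S) ^ 2 ∧ S ^ 2 ≤ (1 + S) ^ 2 := ⟨by nlinarith only [hS0, sq_nonneg S], by nlinarith only [hS0]⟩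
  have hStc : S * t ≤ c₀ := by linarith only [hsmall, mul_le_mul_of_nonneg_right hSsq (add_nonneg ht0 ht₂0), mul_nonneg hS0 ht₂0]
  have hSt₂c : S * t₂ ≤ c₀ := by linarith only [hsmall, mul_le_mul_of_nonneg_right hSsq (add_nonneg ht0 ht₂0), mul_nonneg hS0 ht0]
  have hS2tc : S ^ 2 * t ≤ c₀ := by linarith only [hsmall, mul_le_mul_of_nonneg_right hS2sq (add_nonneg ht0 ht₂0), mul_nonneg (sq_nonneg S) ht₂0]
  have ht1 : t ≤ 1 := htc.trans (hc₀1.trans (by norm_num))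
  obtain ⟨hLk0, hLr0⟩ : 0 < Lk ∧ 0 < Lr := ⟨by linarith only [hLk1], by linarith only [hLr1]⟩
  have hnr0 : 0 < nr := by rw [hnrdef]; positivity
  obtain ⟨hη, hη'⟩ : 0 < η ∧ 0 < η' := ⟨by rw [hηdef]; exact inv_pos.mpr hLk0, by rw [hηqdef]; exact inv_pos.mpr hnr0⟩
  have hη1 : η ≤ 1 := by rw [hηdef]; exact inv_le_one_of_one_le₀ hLk1
  obtain ⟨hLkη, hnrη'⟩ : Lk * η = 1 ∧ nr * η' = 1 := ⟨by rw [hηdef]; exact mul_inv_cancel₀ hLk0.ne', by rw [hηqdef]; exact mul_inv_cancel₀ hnr0.ne'⟩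
  have hLrη' : Lr * η' = η := by
    rw [hηqdef, hηdef, hnrdef, mul_inv, ← mul_assoc, mul_inv_cancel₀ hLr0.ne', one_mul]
  have hη'1 : η' ≤ 1 := (by rw [← hLrη']; exact le_mul_of_one_le_left hη'.le hLr1 : η' ≤ η).trans hη1
  -- the printed letters
  have hexp3 : Real.exp (η' * t) ≤ 3 :=
    (Real.exp_le_exp.mpr (mul_le_one₀ hη'1 ht0 ht1)).trans (by linarith only [Real.exp_one_lt_d9])
  obtain ⟨hpf0, hqf0⟩ : 0 ≤ pf ∧ 0 ≤ qf := ⟨by rw [hpfdef]; positivity, by rw [hqfdef]; positivity⟩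
  obtain ⟨hpf, hqf⟩ : pf ≤ 3 * t ∧ qf ≤ 3 * t₂ := ⟨by rw [hpfdef]; nlinarith only [hexp3, ht0], by rw [hqfdef]; nlinarith only [hexp3, ht₂0]⟩
  have hEp0 : 0 ≤ Ep := by
    have := one_le_pow₀ (M₀ := ℝ) (a := 1 + η' * pf) (le_add_of_nonneg_right (mul_nonneg hη'.le hpf0)) (n := Nr); rw [hEpdef]; linarith only [this]
  have hηpf : η * pf ≤ 1 := by linarith only [mul_le_of_le_one_left hpf0 hη1, hpf, htc, hc₀1]
  have hEp : Ep ≤ 2 * (η * pf) := by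
    have h := one_add_pow_sub_one_le (mul_nonneg hη'.le hpf0) (n := Nr) (by rw [hNr, ← mul_assoc, hLrη']; exact hηpf)
    rw [hNr, show Lr * (η' * pf) = (Lr * η') * pf by ring, hLrη'] at h; rw [hEpdef]; exact h
  obtain ⟨hP0, hP⟩ : 0 ≤ P ∧ P ≤ 2 * pf := ⟨by rw [hPdef]; exact div_nonneg hEp0 hη.le, by rw [hPdef, div_le_iff₀ hη]; linarith only [hEp]⟩
  have hP6 : P ≤ 6 * t := by linarith only [hP, hpf]
  have hQq0 : 0 ≤ Qq := by rw [hQqdef]; positivity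
  have hQq : Qq ≤ 6 * t₂ := by
    have h1 : (1 + η' * pf) ^ Nr = Ep + 1 := by rw [hEpdef]; ring
    rw [hQqdef, h1]
    have h2 : Ep ≤ 1 := by linarith only [hEp, mul_le_of_le_one_left hpf0 hη1, hpf, htc, hc₀1]
    nlinarith only [h2, hqf, hqf0, hEp0]
  have hP1S : P1 = S * P := by rw [hP1def, hSdef]; ring
  have hP10 : 0 ≤ P1 := hP1S ▸ mul_nonneg hS0 hP0
  have hP1 : P1 ≤ 6 * (S * t) := by rw [hP1S]; nlinarith only [mul_le_mul_of_nonneg_left hP6 hS0]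
  have hP1c : P1 ≤ 6 * c₀ := by linarith only [hP1, hStc]
  have hQ1S : Q1 = S * Qq := by rw [hQ1def, hSdef]; ring
  obtain ⟨hQ10, hQ1c⟩ : 0 ≤ Q1 ∧ Q1 ≤ 6 * c₀ := ⟨hQ1S ▸ mul_nonneg hS0 hQq0, by rw [hQ1S]; linarith only [mul_le_mul_of_nonneg_left hQq hS0, hSt₂c]⟩
  have hEP0 : 0 ≤ EP := by
    have := one_le_pow₀ (M₀ := ℝ) (a := 1 + η' * P) (le_add_of_nonneg_right (mul_nonneg hη'.le hP0)) (n := Nr); rw [hEPdef]; linarith only [this]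
  have hEP : EP ≤ 2 * (η * P) := by
    have h := one_add_pow_sub_one_le (mul_nonneg hη'.le hP0) (n := Nr) (by
      rw [hNr, ← mul_assoc, hLrη']; linarith only [mul_le_of_le_one_left hP0 hη1, hP6, htc, hc₀1])
    rw [hNr, show Lr * (η' * P) = (Lr * η') * P by ring, hLrη'] at h; rw [hEPdef]; exact h
  have hPC0 : 0 ≤ PC := by rw [hPCdef]; positivity
  have hPCc : PC ≤ 12 * c₀ := by
    have e1 : PC = S * (Lk * EP) := by rw [hPCdef, hSdef]; ring
    have h2 : Lk * EP ≤ 2 * P := by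
      calc Lk * EP ≤ Lk * (2 * (η * P)) := mul_le_mul_of_nonneg_left hEP hLk0.le
        _ = 2 * (Lk * η) * P := by ring
        _ = 2 * P := by rw [hLkη]; ring
    rw [e1]; linarith only [mul_le_mul_of_nonneg_left h2 hS0, mul_le_mul_of_nonneg_left hP6 hS0, hStc]
  have hE30 : 0 ≤ E3 := by
    have := one_le_pow₀ (M₀ := ℝ) (a := 1 + I * (η' * P1)) (le_add_of_nonneg_right (by positivity)) (n := Nr); rw [hE3def]; linarith only [this]
  have hIP1 : I * P1 ≤ I * (6 * c₀) := mul_le_mul_of_nonneg_left hP1c hI0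
  have hIc' : 6 * ((dd + 1) * ((I + 1) * c₀)) ≤ 1 := by
    nlinarith only [hIc, hK₁0, mul_nonneg (mul_nonneg (mul_nonneg hdd1p hI1p) hc₀pos.le) hK₁0, mul_nonneg (mul_nonneg hdd1p hI1p) hc₀pos.le]
  have hIηP1 : (dd + 1) * (I * (η * P1)) ≤ 1 := by
    have h1 : I * (η * P1) ≤ I * (6 * c₀) := (mul_le_mul_of_nonneg_left (mul_le_of_le_one_left hP10 hη1) hI0).trans hIP1
    have h2 := mul_le_mul_of_nonneg_left h1 hdd1p
    nlinarith only [h2, hIc', hc₀pos.le, hdd1p]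
  have hE3 : E3 ≤ 2 * (I * (η * P1)) := by
    have h := one_add_pow_sub_one_le (a := I * (η' * P1)) (by positivity) (n := Nr) (by
      rw [hNr, show Lr * (I * (η' * P1)) = I * (Lr * η') * P1 by ring, hLrη']
      nlinarith only [hIηP1, hdd0, mul_nonneg hI0 (mul_nonneg hη.le hP10)])
    rw [hNr, show Lr * (I * (η' * P1)) = I * (Lr * η') * P1 by ring, hLrη'] at h
    rw [hE3def]; linarith only [h]
  -- (i) the threshold
  have hRV0 : 0 ≤ RV := by rw [hRVdef, hJ]; positivity
  have hP1sq : P1 ^ 2 ≤ 36 * c₀ := by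
    have h1a : P1 * P1 ≤ (6 * (S * t)) * (6 * (S * t)) := mul_le_mul hP1 hP1 hP10 (by positivity)
    have h1b : S ^ 2 * t * t ≤ S ^ 2 * t * 1 := mul_le_mul_of_nonneg_left ht1 (by positivity)
    nlinarith only [h1a, h1b, hS2tc]
  have hRV : RV ≤ K₁ * c₀ := by
    rw [hRVdef, hJ, hK₁]
    nlinarith only [hIP1, mul_le_mul_of_nonneg_left hP1sq (mul_nonneg (mul_nonneg hI0 hdd1p) hI0), mul_le_mul_of_nonneg_left hQ1c (mul_nonneg hI0 hdd1p)]
  have hRVd : (dd + 1) * RV ≤ 1 / 100 := by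
    have h1 : (dd + 1) * RV ≤ (dd + 1) * (K₁ * c₀) := mul_le_mul_of_nonneg_left hRV hdd1p
    have hK : K₁ * c₀ ≤ (I + 1) * ((K₁ + 1) * c₀) := by nlinarith only [hI0, hK₁0, hc₀pos.le, mul_nonneg hI0 (mul_nonneg hK₁0 hc₀pos.le), mul_nonneg hI0 hc₀pos.le]
    have h2 := mul_le_mul_of_nonneg_left hK hdd1p
    linarith only [h1, h2, hIc]
  have hRV1 : RV ≤ 1 := by nlinarith only [hRVd, hRV0, hdd0, mul_nonneg hdd0 hRV0]
  have hE10 : 0 ≤ E1 := by have := one_le_pow₀ (M₀ := ℝ) (a := 1 + RV * η) (le_add_of_nonneg_right (by positivity)) (n := M1); rw [hE1def]; linarith only [this]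
  have hE20 : 0 ≤ E2 := by have := one_le_pow₀ (M₀ := ℝ) (a := 1 + RV * η') (le_add_of_nonneg_right (by positivity)) (n := M2); rw [hE2def]; linarith only [this]
  have hE1 : E1 ≤ 2 * ((dd + 1) * RV) := by
    have hN : (M1 : ℝ) * (RV * η) = (dd + 1) * RV * (Lk * η) := by rw [hM1]; ring
    have h := one_add_pow_sub_one_le (a := RV * η) (by positivity) (n := M1) (by rw [hN, hLkη, mul_one]; linarith only [hRVd])
    rw [hN, hLkη, mul_one] at h; rw [hE1def]; exact h
  have hE2 : E2 ≤ 2 * ((dd + 1) * RV) := by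
    have hN : (M2 : ℝ) * (RV * η') = (dd + 1) * RV * (nr * η') := by rw [hM2]; ring
    have h := one_add_pow_sub_one_le (a := RV * η') (by positivity) (n := M2) (by rw [hN, hnrη', mul_one]; linarith only [hRVd])
    rw [hN, hnrη', mul_one] at h; rw [hE2def]; exact h
  have hRle : RV * (1 + JJ) + (a₀ * (I * (I * E1 ^ 2 + 2 * E1)) + a₀ * (I * (I * E2 ^ 2 + 2 * E2))) ≤ R₀ := by
    have hRV2 : RV * RV ≤ RV * 1 := mul_le_mul_of_nonneg_left hRV1 hRV0
    have h1 : E1 ^ 2 ≤ 4 * (dd + 1) ^ 2 * RV := by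
      nlinarith only [mul_le_mul hE1 hE1 hE10 (by positivity), mul_le_mul_of_nonneg_left hRV2 (by positivity : (0:ℝ) ≤ 4 * (dd + 1) ^ 2)]
    have h2 : E2 ^ 2 ≤ 4 * (dd + 1) ^ 2 * RV := by
      nlinarith only [mul_le_mul hE2 hE2 hE20 (by positivity), mul_le_mul_of_nonneg_left hRV2 (by positivity : (0:ℝ) ≤ 4 * (dd + 1) ^ 2)]
    have h3 : RV * (1 + JJ) + (a₀ * (I * (I * E1 ^ 2 + 2 * E1)) + a₀ * (I * (I * E2 ^ 2 + 2 * E2))) ≤ RV * K₂ := by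
      rw [hJJ, hK₂]
      nlinarith only [mul_le_mul_of_nonneg_left h1 (mul_nonneg ha₀.le (mul_nonneg hI0 hI0)), mul_le_mul_of_nonneg_left h2 (mul_nonneg ha₀.le (mul_nonneg hI0 hI0)),
        mul_le_mul_of_nonneg_left hE1 (mul_nonneg ha₀.le hI0), mul_le_mul_of_nonneg_left hE2 (mul_nonneg ha₀.le hI0)]
    have h4 : RV * K₂ ≤ K₁ * c₀ * K₂ := mul_le_mul_of_nonneg_right hRV hK₂0
    have h5 : K₁ * K₂ * c₀ ≤ R₀ := by
      have h := hc₀b; rw [le_div_iff₀ (by positivity)] at h; nlinarith only [h, hc₀pos.le]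
    nlinarith only [h3, h4, h5]
  refine ⟨hRle, ?_⟩
  -- (ii) the rate
  have hX : X ≤ (dd + 2) * Lr := by rw [hXdef, hdd1, hLrmdef]; nlinarith only [hdd0]
  have hX0 : 0 ≤ X := by rw [hXdef, hdd1, hLrmdef]; nlinarith only [mul_nonneg hdd0 (sub_nonneg.mpr hLr1), hLr1]
  have hINNER : INNER ≤ η * KI := by
    rw [hINNERdef, hKI]
    have h1 : nr * (κ * (sm * (X * (η' ^ 2 * qf))) + E3 * (η' * P1)) = S * ((nr * η') * ((X * η') * qf)) + (nr * η') * (E3 * P1) := by rw [hSdef]; ring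
    have h2 : X * η' ≤ (dd + 2) * η := by
      calc X * η' ≤ (dd + 2) * Lr * η' := mul_le_mul_of_nonneg_right hX hη'.le
        _ = (dd + 2) * η := by rw [mul_assoc, hLrη']
    rw [h1, hnrη', one_mul, one_mul]
    have h3 : S * ((X * η') * qf) ≤ 3 * (dd + 2) * c₀ * η := by
      calc S * ((X * η') * qf) ≤ S * ((dd + 2) * η * (3 * t₂)) := mul_le_mul_of_nonneg_left (mul_le_mul h2 hqf hqf0 (by positivity)) hS0
        _ = 3 * (dd + 2) * (S * t₂) * η := by ring
        _ ≤ 3 * (dd + 2) * c₀ * η := by nlinarith only [mul_le_mul_of_nonneg_left hSt₂c (show (0:ℝ) ≤ 3 * (dd + 2) * η by positivity)]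
    have h4 : E3 * P1 ≤ 72 * I * c₀ * η := by
      calc E3 * P1 ≤ (2 * (I * (η * P1))) * P1 := mul_le_mul_of_nonneg_right hE3 hP10
        _ = 2 * I * η * P1 ^ 2 := by ring
        _ ≤ 2 * I * η * (36 * c₀) := mul_le_mul_of_nonneg_left hP1sq (by positivity)
        _ = 72 * I * c₀ * η := by ring
    nlinarith only [h3, h4]
  have hINNER0 : 0 ≤ INNER := by rw [hINNERdef]; positivity
  have hTA : TA ≤ η * (I * KI) := by rw [hTAdef]; nlinarith only [mul_le_mul_of_nonneg_left hINNER hI0]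
  have hTC : TC ≤ I * (dd + 1) * oB + η * (I ^ 2 * (dd + 1) * KI) := by
    rw [hTCdef, hJ]
    have h1 : P1 + PC ≤ 1 := by linarith only [hP1c, hPCc, hc₀1]
    have h2 : INNER * (P1 + PC) ≤ η * KI := (mul_le_of_le_one_right hINNER0 h1).trans hINNER
    nlinarith only [mul_le_mul_of_nonneg_left h2 (mul_nonneg hI0 (mul_nonneg hdd1p hI0))]
  have hKTH : KTH ≤ η * ((dd + 1) * (3 * dd + 6) * c₀) := by
    rw [hKTHdef]
    have h1 : nr * (Lr * (η' ^ 2 * qf)) = (nr * η') * (Lr * η') * qf := by ring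
    rw [h1, hnrη', hLrη', one_mul]
    have h2 : κ * (sm * ((dd + 1) * (dd * (η * qf) + Ep))) = (dd + 1) * (dd * (η * (S * qf)) + S * Ep) := by rw [hSdef]; ring
    rw [h2]
    have h3 : S * qf ≤ 3 * c₀ := by linarith only [mul_le_mul_of_nonneg_left hqf hS0, hSt₂c]
    have h4 : S * Ep ≤ 6 * c₀ * η := by
      calc S * Ep ≤ S * (2 * (η * pf)) := mul_le_mul_of_nonneg_left hEp hS0
        _ = 2 * η * (S * pf) := by ring
        _ ≤ 2 * η * (3 * c₀) := mul_le_mul_of_nonneg_left (by linarith only [mul_le_mul_of_nonneg_left hpf hS0, hStc]) (by positivity)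
        _ = 6 * c₀ * η := by ring
    nlinarith only [mul_le_mul_of_nonneg_left (add_le_add (mul_le_mul_of_nonneg_left (mul_le_mul_of_nonneg_left h3 hη.le) hdd0) h4) hdd1p]
  have hKTH0 : 0 ≤ KTH := by rw [hKTHdef]; positivity
  have hON : ON ≤ L2inv * Bc + η * (2 * a₀ * I ^ 2 * ((dd + 1) * (3 * dd + 6) * c₀)) := by
    rw [hONdef, hBc]
    have h1 : |aKrk - aKk| * (1 + I) ≤ 2 * a₀ * L2inv * (1 + I) := mul_le_mul_of_nonneg_right hΔaK (by linarith only [hI0])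
    have h2 : |aKk| * (2 * I * KTH) ≤ a₀ * (2 * I * (η * ((dd + 1) * (3 * dd + 6) * c₀))) :=
      mul_le_mul haK (mul_le_mul_of_nonneg_left hKTH (by positivity)) (by positivity) ha₀.le
    nlinarith only [mul_le_mul_of_nonneg_left (add_le_add h1 h2) hI0]
  have hE40 : 0 ≤ E4 := by
    have := one_le_pow₀ (M₀ := ℝ) (a := 1 + I * (η' * P1)) (le_add_of_nonneg_right (by positivity)) (n := M4); rw [hE4def]; linarith only [this]
  have hE4 : E4 ≤ η * (12 * (dd + 1) * I * c₀) := by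
    have hN : (M4 : ℝ) ≤ (dd + 1) * Lr := by rw [hM4, hLrmdef]; nlinarith only [hdd0]
    have hNa : (M4 : ℝ) * (I * (η' * P1)) ≤ (dd + 1) * (I * (η * P1)) := by
      calc (M4 : ℝ) * (I * (η' * P1)) ≤ (dd + 1) * Lr * (I * (η' * P1)) := mul_le_mul_of_nonneg_right hN (by positivity)
        _ = (dd + 1) * (I * ((Lr * η') * P1)) := by ring
        _ = (dd + 1) * (I * (η * P1)) := by rw [hLrη']
    have h := one_add_pow_sub_one_le (a := I * (η' * P1)) (by positivity) (n := M4) (hNa.trans hIηP1)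
    rw [hE4def]
    calc _ ≤ 2 * ((M4 : ℝ) * (I * (η' * P1))) := h
      _ ≤ 2 * ((dd + 1) * (I * (η * P1))) := by linarith only [hNa]
      _ = 2 * (dd + 1) * η * (I * P1) := by ring
      _ ≤ 2 * (dd + 1) * η * (I * (6 * c₀)) := mul_le_mul_of_nonneg_left hIP1 (by positivity)
      _ = η * (12 * (dd + 1) * I * c₀) := by ring
  obtain ⟨hTA0, hTC0, hON0⟩ : 0 ≤ TA ∧ 0 ≤ TC ∧ 0 ≤ ON := ⟨by rw [hTAdef]; positivity, by rw [hTCdef, hJ]; positivity, by rw [hONdef]; positivity⟩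
  have hA' : (0 : ℝ) ≤ (I * KI + I ^ 2 * (dd + 1) * KI) * (1 + 2 * (dd + 1)) + 2 * a₀ * I ^ 2 * ((dd + 1) * (3 * dd + 6) * c₀) + 12 * (dd + 1) * I * c₀ := by positivity
  have hsumR : (TA + TC) * (1 + JJ) + ON + E4 ≤ (Aη + Bc + KB) * (x14 + oB) := by
    rw [hJJ, hAη, hKB]
    nlinarith only [mul_le_mul_of_nonneg_right (add_le_add hTA hTC) (show (0:ℝ) ≤ 1 + 2 * (dd + 1) by positivity), hON, hE4,
      mul_le_mul_of_nonneg_right hηx hA', mul_le_mul_of_nonneg_right hL2x hBc0, mul_nonneg hA' hoB, mul_nonneg hBc0 hoB,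
      mul_nonneg (show (0:ℝ) ≤ I * (dd + 1) * (1 + 2 * (dd + 1)) by positivity) hx0, hoB, hx0, hI0, hdd0]
  have hrate0 : 0 ≤ x14 + ((TA + TC) * (1 + JJ) + ON + E4) := by rw [hJJ]; positivity
  calc D * (x14 + ((TA + TC) * (1 + JJ) + ON + E4)) * ex
      ≤ max D 0 * (x14 + ((TA + TC) * (1 + JJ) + ON + E4)) * ex :=
        mul_le_mul_of_nonneg_right (mul_le_mul_of_nonneg_right (le_max_left _ _) hrate0) hex.le
    _ ≤ max D 0 * ((1 + Aη + Bc + KB) * (x14 + oB)) * ex := by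
        refine mul_le_mul_of_nonneg_right (mul_le_mul_of_nonneg_left ?_ (le_max_right _ _)) hex.le
        nlinarith only [hsumR, hoB, hx0, hAη0, hBc0, hKB0]
    _ = max D 0 * (1 + Aη + Bc + KB) * (x14 + oB) * ex := by ring

/-! ## §3 The small-data form -/

section Small

variable {L : ℕ} [NeZero L]
set_option maxHeartbeats 3200000 in
/-- ★★★ **THE SMALL-DATA FORM**: `(1 + κ√|m|)²(C∕ξ + C∕ξ²) ≤ c₀` ⟹ the two-grid η-defect of the glued scalar covariant Green's functions from ONE (3.35) datum per cube is `≤ D′·(L^{−k∕4} +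
o_B)·e^{−(δ∕16)dist}` (n15-c∕354, every auxiliary letter and threshold eliminated). [cite: Balaban1985BackgroundPropagators, (3.35) p.396, (3.51)–(3.52) p.400 (shapes); King1986, p.664 (pairing)] -/
theorem uN_idef_scGreen_tr_of_reg335_small (hL : Odd L ∧ 1 < L) (hL7 : 7 ≤ L) {a₀ : ℝ} (ha₀ : 0 < a₀) (ι : Type) [Fintype ι] [DecidableEq ι] :
    ∃ δ w₀ c₀ D : ℝ, 0 < δ ∧ 0 < c₀ ∧ ∀ (mv kk r : ℕ), 1 ≤ kk → 1 ≤ r → w₀ ≤ ((L ^ mv : ℕ) : ℝ) →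
      ∀ {mm : Type} [Fintype mm] [DecidableEq mm] [Nonempty mm] (e : Matrix mm mm ℂ ≃L[ℝ] (ι → ℝ)), (∀ A B : Matrix mm mm ℂ, traceForm A B = e A ⬝ᵥ e B) →
      ∀ (U' : Fin (d + 1) → ScX' d L mv kk r hL → (Matrix mm mm ℂ)ˣ), (∀ μ x', (U' μ x' : Matrix mm mm ℂ) ∈ Matrix.unitaryGroup mm ℂ) →
      ∀ (Q : (Fin (d + 1) → ZMod (2 * L)) → Set (ScX' d L mv kk r hL)) (ξ C : ℝ), 0 < ξ → 0 ≤ C →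
        (1 + @basisConst ι _ (Matrix mm mm ℂ) Matrix.frobeniusNormedAddCommGroup Matrix.frobeniusNormedSpace e * (2 * Real.sqrt (Fintype.card mm)) * Real.sqrt (Fintype.card mm)) ^ 2 * (C / ξ + C / ξ ^ 2) ≤ c₀ →
        (∀ k, Reg335Cube (scShift' d L mv kk r hL) U' ((((L ^ r * L ^ kk : ℕ) : ℝ))⁻¹) (Q k) ξ C) →
        (∀ k z, (∃ y ∈ cvSk d L mv kk hL k, (unitTorusGeo L kk (cvM d L mv kk hL)).dist (scBlk' d L mv kk r hL z) y ≤ 5) → z ∈ Q k) →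
      ∀ (oB : ℝ), 0 ≤ oB →
      ∃ u' : (Fin (d + 1) → ZMod (2 * L)) → ScX' d L mv kk r hL → Matrix mm mm ℂ, (∀ k x', (u' k x')ᴴ * u' k x' = 1) ∧
       ((∀ k μ x', scChi d L mv kk hL k (kingPr L kk r (cvM d L mv kk hL) x') ≠ 0 → ∀ i j, |(((((((L ^ r * L ^ kk : ℕ) : ℝ))⁻¹))⁻¹ * (((((L ^ r * L ^ kk : ℕ) : ℝ))⁻¹))⁻¹) • (coordMat e (ContinuousLinearMap.mulLeftRight ℝ (Matrix mm mm ℂ) (u' k x' * (U' μ x' : Matrix mm mm ℂ) * (u' k (scShift' d L mv kk r hL μ x'))ᴴ) (u' k x' * (U' μ x' : Matrix mm mm ℂ) * (u' k (scShift' d L mv kk r hL μ x'))ᴴ)ᴴ) - coordMat e (ContinuousLinearMap.mulLeftRight ℝ (Matrix mm mm ℂ) (u' k ((scShift' d L mv kk r hL μ).symm x') * (U' μ ((scShift' d L mv kk r hL μ).symm x') : Matrix mm mm ℂ) * (u' k (scShift' d L mv kk r hL μ ((scShift' d L mv kk r hL μ).symm x')))ᴴ) (u' k ((scShift' d L mv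 kk r hL μ).symm x') * (U' μ ((scShift' d L mv kk r hL μ).symm x') : Matrix mm mm ℂ) * (u' k (scShift' d L mv kk r hL μ ((scShift' d L mv kk r hL μ).symm x')))ᴴ)ᴴ)) -
      ((((((L ^ kk : ℕ) : ℝ))⁻¹))⁻¹ * (((((L ^ kk : ℕ) : ℝ))⁻¹))⁻¹) • (coordMat e (ContinuousLinearMap.mulLeftRight ℝ (Matrix mm mm ℂ) (u' k (kingSec (cvM d L mv kk hL) L kk r (kingPr L kk r (cvM d L mv kk hL) x')) * mprod (fun t => (U' μ (kingSec (cvM d L mv kk hL) L kk r (kingPr L kk r (cvM d L mv kk hL) x') + t • unitVec (fine (L ^ r * L ^ kk) (cvM d L mv kk hL)) μ) : Matrix mm mm ℂ)) (L ^ r) * (u' k (kingSec (cvM d L mv kk hL) L kk r (scShift d L mv kk hL μ (kingPr L kk r (cvM d L mv kk hL) x'))))ᴴ) (u' k (kingSec (cvM d L mv kk hL) L kk r (kingPr L kk r (cvM d L mv kk hL) x')) * mprod (fun t => (U' μ (kingSec (cvM d L mv kk hL) L kk r (kingPr L kk r (cvM d L mv kk hL) x') + t • unitVec (fine (L ^ r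 * L ^ kk) (cvM d L mv kk hL)) μ) : Matrix mm mm ℂ)) (L ^ r) * (u' k (kingSec (cvM d L mv kk hL) L kk r (scShift d L mv kk hL μ (kingPr L kk r (cvM d L mv kk hL) x'))))ᴴ)ᴴ) - coordMat e (ContinuousLinearMap.mulLeftRight ℝ (Matrix mm mm ℂ) (u' k (kingSec (cvM d L mv kk hL) L kk r ((scShift d L mv kk hL μ).symm (kingPr L kk r (cvM d L mv kk hL) x'))) * mprod (fun t => (U' μ (kingSec (cvM d L mv kk hL) L kk r ((scShift d L mv kk hL μ).symm (kingPr L kk r (cvM d L mv kk hL) x')) + t • unitVec (fine (L ^ r * L ^ kk) (cvM d L mv kk hL)) μ) : Matrix mm mm ℂ)) (L ^ r) * (u' k (kingSec (cvM d L mv kk hL) L kk r (scShift d L mv kk hL μ ((scShift d L mv kk hL μ).symm (kingPr L kk r (cvM d L mv kk hL) x')))))ᴴ) (u' k (kingSec (cvM d L mv kk hL) L kk r ((scShift d L mv kk hL μ).symm (kingPr L kk r (cvM d L mv kk hL) x'))) * mprod (fun t => (U' μ (kingSec (cvM d L mv kk hL) L kk r ((scShift d L mv kk hL μ).symm (kingPr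 L kk r (cvM d L mv kk hL) x')) + t • unitVec (fine (L ^ r * L ^ kk) (cvM d L mv kk hL)) μ) : Matrix mm mm ℂ)) (L ^ r) * (u' k (kingSec (cvM d L mv kk hL) L kk r (scShift d L mv kk hL μ ((scShift d L mv kk hL μ).symm (kingPr L kk r (cvM d L mv kk hL) x')))))ᴴ)ᴴ))) i j| ≤ oB) →
        HasMaj (ScNorm d L mv kk hL ι) (BlockNorm.ofBlocks (unitTorusGeo L kk (cvM d L mv kk hL)) (liftBlk (scBlk d L mv kk hL ∘ kingPr L kk r (cvM d L mv kk hL)) ι))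
          (idef (ctauS (cvM d L mv kk hL) L kk r (fun μ x' => coordMat e (ContinuousLinearMap.mulLeftRight ℝ (Matrix mm mm ℂ) ((U' μ x' : Matrix mm mm ℂ)) ((U' μ x' : Matrix mm mm ℂ))ᴴ))) (ctauS (cvM d L mv kk hL) L kk r (fun μ x' => coordMat e (ContinuousLinearMap.mulLeftRight ℝ (Matrix mm mm ℂ) ((U' μ x' : Matrix mm mm ℂ)) ((U' μ x' : Matrix mm mm ℂ))ᴴ))) (scGlued' d L mv kk r hL (aK a₀ (L : ℝ) (r + kk) * (((L ^ r * L ^ kk : ℕ) : ℝ)) ^ (d + 1)) ((((L ^ r * L ^ kk : ℕ) : ℝ))⁻¹) ι e u' (fun μ z => (U' μ z : Matrix mm mm ℂ)) (scP' d L mv kk r hL (aK a₀ (L : ℝ) (r + kk) * (((L ^ r * L ^ kk : ℕ) : ℝ)) ^ (d + 1)) ι e (fun μ z => (U' μ z : Matrix mm mm ℂ))) (scNV' d L mv kk r hL (aK a₀ (L : ℝ) (r + kk) * (((L ^ r * L ^ kk : ℕ) : ℝ)) ^ (d + 1)) ι e u' (fun μ z => (U' μ z : Matrix mm mm ℂ))))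 (scGlued d L mv kk hL (aK a₀ (L : ℝ) kk * (((L ^ kk : ℕ) : ℝ)) ^ (d + 1)) ((((L ^ kk : ℕ) : ℝ))⁻¹) ι e (fun k x => u' k (kingSec (cvM d L mv kk hL) L kk r x)) (fun μ y => mprod (fun t => (U' μ (kingSec (cvM d L mv kk hL) L kk r y + t • unitVec (fine (L ^ r * L ^ kk) (cvM d L mv kk hL)) μ) : Matrix mm mm ℂ)) (L ^ r)) (scP d L mv kk hL (aK a₀ (L : ℝ) kk * (((L ^ kk : ℕ) : ℝ)) ^ (d + 1)) ι e (fun μ y => mprod (fun t => (U' μ (kingSec (cvM d L mv kk hL) L kk r y + t • unitVec (fine (L ^ r * L ^ kk) (cvM d L mv kk hL)) μ) : Matrix mm mm ℂ)) (L ^ r))) (scNV d L mv kk hL (aK a₀ (L : ℝ) kk * (((L ^ kk : ℕ) : ℝ)) ^ (d + 1)) ι e (fun k x => u' k (kingSec (cvM d L mv kk hL) L kk r x)) (fun μ y => mprod (fun t => (U' μ (kingSec (cvM d L mv kk hL) L kk r y + t • unitVec (fine (L ^ r * L ^ kk) (cvM d L mv kk hL)) μ) : Matrix mm mm ℂ))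 (L ^ r)))))
          (fun y y' => D * (((L : ℝ) ^ kk) ^ (-(1 / 4 : ℝ)) + oB) * Real.exp (-(δ / 16 * (unitTorusGeo L kk (cvM d L mv kk hL)).dist y y')))) := by
  obtain ⟨δ, w₀, R₀, D, hδ, hR₀, H⟩ := uN_idef_scGreen_tr_of_reg335_letters (d := d) hL hL7 ha₀ ι
  have hLpos : 0 < L := (by have := hL.2; omega)
  have hL1r : (1 : ℝ) < (L : ℝ) := by exact_mod_cast hL.2
  have hL2r : (2 : ℝ) ≤ (L : ℝ) := by exact_mod_cast (show 2 ≤ L by have := hL.2; omega)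
  have hI0 : (0 : ℝ) ≤ (Fintype.card ι : ℝ) := Nat.cast_nonneg _
  have hdd0 : (0 : ℝ) ≤ (d : ℝ) := Nat.cast_nonneg _
  obtain ⟨K₁, hK₁⟩ : ∃ K₁ : ℝ, K₁ = (Fintype.card ι : ℝ) * (6 + ((d : ℝ) + 1) * (36 * (Fintype.card ι : ℝ) + 6)) := ⟨_, rfl⟩
  obtain ⟨K₂, hK₂⟩ : ∃ K₂ : ℝ, K₂ = (1 + 2 * ((d : ℝ) + 1)) + 2 * a₀ * (Fintype.card ι : ℝ) * (4 * ((d : ℝ) + 1) ^ 2 * (Fintype.card ι : ℝ) + 4 * ((d : ℝ) + 1)) := ⟨_, rfl⟩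
  obtain ⟨hK₁0, hK₂0⟩ : 0 ≤ K₁ ∧ 0 ≤ K₂ := ⟨by rw [hK₁]; positivity, by rw [hK₂]; positivity⟩
  obtain ⟨c₀, hc₀⟩ : ∃ c₀ : ℝ, c₀ = min (1 / (100 * ((d : ℝ) + 1) * ((Fintype.card ι : ℝ) + 1) * (K₁ + 1))) (R₀ / (K₁ * K₂ + 1)) := ⟨_, rfl⟩
  have hc₀pos : 0 < c₀ := by rw [hc₀]; exact lt_min (by positivity) (by positivity)
  have hc₀a : c₀ ≤ 1 / (100 * ((d : ℝ) + 1) * ((Fintype.card ι : ℝ) + 1) * (K₁ + 1)) := by rw [hc₀]; exact min_le_left _ _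
  have hc₀b : c₀ ≤ R₀ / (K₁ * K₂ + 1) := by rw [hc₀]; exact min_le_right _ _
  obtain ⟨KI, hKI⟩ : ∃ KI : ℝ, KI = (3 * ((d : ℝ) + 2) + 72 * (Fintype.card ι : ℝ)) * c₀ := ⟨_, rfl⟩
  obtain ⟨Aη, hAη⟩ : ∃ Aη : ℝ, Aη = ((Fintype.card ι : ℝ) * KI + (Fintype.card ι : ℝ) ^ 2 * ((d : ℝ) + 1) * KI) * (1 + 2 * ((d : ℝ) + 1)) +
      2 * a₀ * (Fintype.card ι : ℝ) ^ 2 * (((d : ℝ) + 1) * (3 * (d : ℝ) + 6) * c₀) + 12 * ((d : ℝ) + 1) * (Fintype.card ι : ℝ) * c₀ := ⟨_, rfl⟩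
  obtain ⟨Bc, hBc⟩ : ∃ Bc : ℝ, Bc = 2 * a₀ * (Fintype.card ι : ℝ) * (1 + (Fintype.card ι : ℝ)) := ⟨_, rfl⟩
  obtain ⟨KB, hKB⟩ : ∃ KB : ℝ, KB = (Fintype.card ι : ℝ) * ((d : ℝ) + 1) * (1 + 2 * ((d : ℝ) + 1)) := ⟨_, rfl⟩
  refine ⟨δ, w₀, c₀, max D 0 * (1 + Aη + Bc + KB), hδ, hc₀pos, fun mv kk r hk hr hw₀ => ?_⟩
  intro mm _ _ _ e he U' hU'g Q ξ C hξ hC hsmall h335 hQ oB hoB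
  have H1 := H mv kk r hk hr hw₀ e he U' hU'g Q ξ C hξ hC h335 hQ oB hoB
  clear H
  have hκ := @basisConst_nonneg ι _ (Matrix mm mm ℂ) Matrix.frobeniusNormedAddCommGroup Matrix.frobeniusNormedSpace e
  have hx1 : (1 : ℝ) ≤ (L : ℝ) ^ kk := one_le_pow₀ hL1r.le
  have hLk1 : (1 : ℝ) ≤ (((L ^ kk : ℕ) : ℝ)) := by exact_mod_cast Nat.one_le_pow _ _ hLpos
  have hLr1 : (1 : ℝ) ≤ ((L ^ r : ℕ) : ℝ) := by exact_mod_cast Nat.one_le_pow _ _ hLpos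
  have key := fun (y y' : Tor (cvM d L mv kk hL)) => letters_bookkeeping ((Fintype.card ι : ℝ)) ((d : ℝ)) (((d + 1 : ℕ) : ℝ)) ((Fintype.card (Fin (d + 1)) : ℝ)) ((Fintype.card (Fin (d + 1) ⊕ Fin (d + 1)) : ℝ)) ((((L ^ r * L ^ kk : ℕ) : ℝ))) ((((L ^ kk : ℕ) : ℝ))) (((L ^ r : ℕ) : ℝ)) (((L ^ r - 1 : ℕ) : ℝ)) (((((L ^ r * L ^ kk : ℕ) : ℝ))⁻¹)) (((((L ^ kk : ℕ) : ℝ))⁻¹)) (@basisConst ι _ (Matrix mm mm ℂ) Matrix.frobeniusNormedAddCommGroup Matrix.frobeniusNormedSpace e * (2 * Real.sqrt (Fintype.card mm))) (Real.sqrt (Fintype.card mm)) ((C / ξ)) ((C / ξ ^ 2)) (((C / ξ) * Real.exp (((((L ^ r * L ^ kk : ℕ) : ℝ))⁻¹) * (C / ξ)))) (((C / ξ ^ 2) * Real.exp (((((L ^ r * L ^ kk : ℕ) : ℝ))⁻¹) * (C / ξ)))) (((1 + ((((L ^ r * L ^ kk : ℕ) : ℝ))⁻¹) * ((C / ξ)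 * Real.exp (((((L ^ r * L ^ kk : ℕ) : ℝ))⁻¹) * (C / ξ)))) ^ (L ^ r) - 1)) ((((1 + ((((L ^ r * L ^ kk : ℕ) : ℝ))⁻¹) * ((C / ξ) * Real.exp (((((L ^ r * L ^ kk : ℕ) : ℝ))⁻¹) * (C / ξ)))) ^ (L ^ r) - 1) / ((((L ^ kk : ℕ) : ℝ))⁻¹))) ((((C / ξ ^ 2) * Real.exp (((((L ^ r * L ^ kk : ℕ) : ℝ))⁻¹) * (C / ξ))) * (1 + ((((L ^ r * L ^ kk : ℕ) : ℝ))⁻¹) * ((C / ξ) * Real.exp (((((L ^ r * L ^ kk : ℕ) : ℝ))⁻¹) * (C / ξ)))) ^ (L ^ r))) ((@basisConst ι _ (Matrix mm mm ℂ) Matrix.frobeniusNormedAddCommGroup Matrix.frobeniusNormedSpace e * (2 * Real.sqrt (Fintype.card mm)) * (Real.sqrt (Fintype.card mm) * (((1 + ((((L ^ r * L ^ kk : ℕ) : ℝ))⁻¹) * ((C / ξ) * Real.exp (((((L ^ r * L ^ kk : ℕ) : ℝ))⁻¹) * (C / ξ)))) ^ (L ^ r) - 1) / ((((L ^ kk :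 ℕ) : ℝ))⁻¹))))) ((@basisConst ι _ (Matrix mm mm ℂ) Matrix.frobeniusNormedAddCommGroup Matrix.frobeniusNormedSpace e * (2 * Real.sqrt (Fintype.card mm)) * (Real.sqrt (Fintype.card mm) * (((C / ξ ^ 2) * Real.exp (((((L ^ r * L ^ kk : ℕ) : ℝ))⁻¹) * (C / ξ))) * (1 + ((((L ^ r * L ^ kk : ℕ) : ℝ))⁻¹) * ((C / ξ) * Real.exp (((((L ^ r * L ^ kk : ℕ) : ℝ))⁻¹) * (C / ξ)))) ^ (L ^ r))))) (((1 + ((((L ^ r * L ^ kk : ℕ) : ℝ))⁻¹) * (((1 + ((((L ^ r * L ^ kk : ℕ) : ℝ))⁻¹) * ((C / ξ) * Real.exp (((((L ^ r * L ^ kk : ℕ) : ℝ))⁻¹) * (C / ξ)))) ^ (L ^ r) - 1) / ((((L ^ kk : ℕ) : ℝ))⁻¹))) ^ (L ^ r) - 1)) (((((L ^ kk : ℕ) : ℝ)) * (@basisConst ι _ (Matrix mm mm ℂ) Matrix.frobeniusNormedAddCommGroup Matrix.frobeniusNormedSpace e * (2 * Real.sqrt (Fintype.card mm)) * (Real.sqrt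 (Fintype.card mm) * ((1 + ((((L ^ r * L ^ kk : ℕ) : ℝ))⁻¹) * (((1 + ((((L ^ r * L ^ kk : ℕ) : ℝ))⁻¹) * ((C / ξ) * Real.exp (((((L ^ r * L ^ kk : ℕ) : ℝ))⁻¹) * (C / ξ)))) ^ (L ^ r) - 1) / ((((L ^ kk : ℕ) : ℝ))⁻¹))) ^ (L ^ r) - 1))))) (((1 + Fintype.card ι * (((((L ^ r * L ^ kk : ℕ) : ℝ))⁻¹) * (@basisConst ι _ (Matrix mm mm ℂ) Matrix.frobeniusNormedAddCommGroup Matrix.frobeniusNormedSpace e * (2 * Real.sqrt (Fintype.card mm)) * (Real.sqrt (Fintype.card mm) * (((1 + ((((L ^ r * L ^ kk : ℕ) : ℝ))⁻¹) * ((C / ξ) * Real.exp (((((L ^ r * L ^ kk : ℕ) : ℝ))⁻¹) * (C / ξ)))) ^ (L ^ r) - 1) / ((((L ^ kk : ℕ) : ℝ))⁻¹)))))) ^ (L ^ r) - 1)) (((((d + 1 : ℕ) : ℝ) * ((L ^ r - 1 : ℕ) : ℝ) + (L ^ r : ℕ) + 1))) ((((L ^ r * L ^ kk : ℕ) : ℝ)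 * (@basisConst ι _ (Matrix mm mm ℂ) Matrix.frobeniusNormedAddCommGroup Matrix.frobeniusNormedSpace e * (2 * Real.sqrt (Fintype.card mm)) * (Real.sqrt (Fintype.card mm) * ((((d + 1 : ℕ) : ℝ) * ((L ^ r - 1 : ℕ) : ℝ) + (L ^ r : ℕ) + 1) * (((((L ^ r * L ^ kk : ℕ) : ℝ))⁻¹) ^ 2 * ((C / ξ ^ 2) * Real.exp (((((L ^ r * L ^ kk : ℕ) : ℝ))⁻¹) * (C / ξ)))))) + ((1 + Fintype.card ι * (((((L ^ r * L ^ kk : ℕ) : ℝ))⁻¹) * (@basisConst ι _ (Matrix mm mm ℂ) Matrix.frobeniusNormedAddCommGroup Matrix.frobeniusNormedSpace e * (2 * Real.sqrt (Fintype.card mm)) * (Real.sqrt (Fintype.card mm) * (((1 + ((((L ^ r * L ^ kk : ℕ) : ℝ))⁻¹) * ((C / ξ) * Real.exp (((((L ^ r * L ^ kk : ℕ) : ℝ))⁻¹) * (C / ξ)))) ^ (L ^ r) - 1) / ((((L ^ kk : ℕ) : ℝ))⁻¹)))))) ^ (L ^ r) - 1) * (((((L ^ r * L ^ kk : ℕ)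 : ℝ))⁻¹) * (@basisConst ι _ (Matrix mm mm ℂ) Matrix.frobeniusNormedAddCommGroup Matrix.frobeniusNormedSpace e * (2 * Real.sqrt (Fintype.card mm)) * (Real.sqrt (Fintype.card mm) * (((1 + ((((L ^ r * L ^ kk : ℕ) : ℝ))⁻¹) * ((C / ξ) * Real.exp (((((L ^ r * L ^ kk : ℕ) : ℝ))⁻¹) * (C / ξ)))) ^ (L ^ r) - 1) / ((((L ^ kk : ℕ) : ℝ))⁻¹)))))))) (Fintype.card ι * (((L ^ r * L ^ kk : ℕ) : ℝ) * (@basisConst ι _ (Matrix mm mm ℂ) Matrix.frobeniusNormedAddCommGroup Matrix.frobeniusNormedSpace e * (2 * Real.sqrt (Fintype.card mm)) * (Real.sqrt (Fintype.card mm) * ((((d + 1 : ℕ) : ℝ) * ((L ^ r - 1 : ℕ) : ℝ) + (L ^ r : ℕ) + 1) * (((((L ^ r * L ^ kk : ℕ) : ℝ))⁻¹) ^ 2 * ((C / ξ ^ 2) * Real.exp (((((L ^ r * L ^ kk : ℕ) : ℝ))⁻¹) * (C / ξ)))))) + ((1 + Fintype.card ι * (((((L ^ r * L ^ kk : ℕ)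 : ℝ))⁻¹) * (@basisConst ι _ (Matrix mm mm ℂ) Matrix.frobeniusNormedAddCommGroup Matrix.frobeniusNormedSpace e * (2 * Real.sqrt (Fintype.card mm)) * (Real.sqrt (Fintype.card mm) * (((1 + ((((L ^ r * L ^ kk : ℕ) : ℝ))⁻¹) * ((C / ξ) * Real.exp (((((L ^ r * L ^ kk : ℕ) : ℝ))⁻¹) * (C / ξ)))) ^ (L ^ r) - 1) / ((((L ^ kk : ℕ) : ℝ))⁻¹)))))) ^ (L ^ r) - 1) * (((((L ^ r * L ^ kk : ℕ) : ℝ))⁻¹) * (@basisConst ι _ (Matrix mm mm ℂ) Matrix.frobeniusNormedAddCommGroup Matrix.frobeniusNormedSpace e * (2 * Real.sqrt (Fintype.card mm)) * (Real.sqrt (Fintype.card mm) * (((1 + ((((L ^ r * L ^ kk : ℕ) : ℝ))⁻¹) * ((C / ξ) * Real.exp (((((L ^ r * L ^ kk : ℕ) : ℝ))⁻¹) * (C / ξ)))) ^ (L ^ r) - 1) / ((((L ^ kk : ℕ) : ℝ))⁻¹)))))))) (Fintype.card ι * (Fintype.card (Fin (d + 1)) * (oB + Fintype.card ι * ((((L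 ^ r * L ^ kk : ℕ) : ℝ) * (@basisConst ι _ (Matrix mm mm ℂ) Matrix.frobeniusNormedAddCommGroup Matrix.frobeniusNormedSpace e * (2 * Real.sqrt (Fintype.card mm)) * (Real.sqrt (Fintype.card mm) * ((((d + 1 : ℕ) : ℝ) * ((L ^ r - 1 : ℕ) : ℝ) + (L ^ r : ℕ) + 1) * (((((L ^ r * L ^ kk : ℕ) : ℝ))⁻¹) ^ 2 * ((C / ξ ^ 2) * Real.exp (((((L ^ r * L ^ kk : ℕ) : ℝ))⁻¹) * (C / ξ)))))) + ((1 + Fintype.card ι * (((((L ^ r * L ^ kk : ℕ) : ℝ))⁻¹) * (@basisConst ι _ (Matrix mm mm ℂ) Matrix.frobeniusNormedAddCommGroup Matrix.frobeniusNormedSpace e * (2 * Real.sqrt (Fintype.card mm)) * (Real.sqrt (Fintype.card mm) * (((1 + ((((L ^ r * L ^ kk : ℕ) : ℝ))⁻¹) * ((C / ξ) * Real.exp (((((L ^ r * L ^ kk : ℕ) : ℝ))⁻¹) * (C / ξ)))) ^ (L ^ r) - 1) / ((((L ^ kk : ℕ) : ℝ))⁻¹)))))) ^ (L ^ r) - 1)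 * (((((L ^ r * L ^ kk : ℕ) : ℝ))⁻¹) * (@basisConst ι _ (Matrix mm mm ℂ) Matrix.frobeniusNormedAddCommGroup Matrix.frobeniusNormedSpace e * (2 * Real.sqrt (Fintype.card mm)) * (Real.sqrt (Fintype.card mm) * (((1 + ((((L ^ r * L ^ kk : ℕ) : ℝ))⁻¹) * ((C / ξ) * Real.exp (((((L ^ r * L ^ kk : ℕ) : ℝ))⁻¹) * (C / ξ)))) ^ (L ^ r) - 1) / ((((L ^ kk : ℕ) : ℝ))⁻¹))))))) * ((@basisConst ι _ (Matrix mm mm ℂ) Matrix.frobeniusNormedAddCommGroup Matrix.frobeniusNormedSpace e * (2 * Real.sqrt (Fintype.card mm)) * (Real.sqrt (Fintype.card mm) * (((1 + ((((L ^ r * L ^ kk : ℕ) : ℝ))⁻¹) * ((C / ξ) * Real.exp (((((L ^ r * L ^ kk : ℕ) : ℝ))⁻¹) * (C / ξ)))) ^ (L ^ r) - 1) / ((((L ^ kk : ℕ) : ℝ))⁻¹)))) + (((L ^ kk : ℕ) : ℝ) * (@basisConst ι _ (Matrix mm mm ℂ) Matrix.frobeniusNormedAddCommGroup Matrix.frobeniusNormedSpace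 e * (2 * Real.sqrt (Fintype.card mm)) * (Real.sqrt (Fintype.card mm) * ((1 + ((((L ^ r * L ^ kk : ℕ) : ℝ))⁻¹) * (((1 + ((((L ^ r * L ^ kk : ℕ) : ℝ))⁻¹) * ((C / ξ) * Real.exp (((((L ^ r * L ^ kk : ℕ) : ℝ))⁻¹) * (C / ξ)))) ^ (L ^ r) - 1) / ((((L ^ kk : ℕ) : ℝ))⁻¹))) ^ (L ^ r) - 1))))))))) ((@basisConst ι _ (Matrix mm mm ℂ) Matrix.frobeniusNormedAddCommGroup Matrix.frobeniusNormedSpace e * (2 * Real.sqrt (Fintype.card mm)) * (Real.sqrt (Fintype.card mm) * ((d + 1) * (d * ((((L ^ r * L ^ kk : ℕ) : ℝ)) * (((L ^ r : ℕ) : ℝ) * (((((L ^ r * L ^ kk : ℕ) : ℝ))⁻¹) ^ 2 * ((C / ξ ^ 2) * Real.exp (((((L ^ r * L ^ kk : ℕ) : ℝ))⁻¹) * (C / ξ)))))) + ((1 + (((((L ^ r * L ^ kk : ℕ) : ℝ))⁻¹) * ((C / ξ) * Real.exp (((((L ^ r * L ^ kk : ℕ) : ℝ))⁻¹) * (C /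 ξ))))) ^ (L ^ r) - 1)))))) ((aK a₀ (L : ℝ) kk)) ((aK a₀ (L : ℝ) (r + kk))) ((Fintype.card ι * (|aK a₀ (L : ℝ) (r + kk) - aK a₀ (L : ℝ) kk| * (1 + Fintype.card ι) + |aK a₀ (L : ℝ) kk| * (2 * Fintype.card ι * (@basisConst ι _ (Matrix mm mm ℂ) Matrix.frobeniusNormedAddCommGroup Matrix.frobeniusNormedSpace e * (2 * Real.sqrt (Fintype.card mm)) * (Real.sqrt (Fintype.card mm) * ((d + 1) * (d * ((((L ^ r * L ^ kk : ℕ) : ℝ)) * (((L ^ r : ℕ) : ℝ) * (((((L ^ r * L ^ kk : ℕ) : ℝ))⁻¹) ^ 2 * ((C / ξ ^ 2) * Real.exp (((((L ^ r * L ^ kk : ℕ) : ℝ))⁻¹) * (C / ξ)))))) + ((1 + (((((L ^ r * L ^ kk : ℕ) : ℝ))⁻¹) * ((C / ξ) * Real.exp (((((L ^ r * L ^ kk : ℕ) : ℝ))⁻¹) * (C / ξ))))) ^ (L ^ r) - 1))))))))) ((Fintype.card ι * (@basisConst ι _ (Matrix mm mm ℂ) Matrix.frobeniusNormedAddCommGroup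 Matrix.frobeniusNormedSpace e * (2 * Real.sqrt (Fintype.card mm)) * (Real.sqrt (Fintype.card mm) * (((1 + ((((L ^ r * L ^ kk : ℕ) : ℝ))⁻¹) * ((C / ξ) * Real.exp (((((L ^ r * L ^ kk : ℕ) : ℝ))⁻¹) * (C / ξ)))) ^ (L ^ r) - 1) / ((((L ^ kk : ℕ) : ℝ))⁻¹)))) + Fintype.card ι * (Fintype.card (Fin (d + 1)) * (Fintype.card ι * (@basisConst ι _ (Matrix mm mm ℂ) Matrix.frobeniusNormedAddCommGroup Matrix.frobeniusNormedSpace e * (2 * Real.sqrt (Fintype.card mm)) * (Real.sqrt (Fintype.card mm) * (((1 + ((((L ^ r * L ^ kk : ℕ) : ℝ))⁻¹) * ((C / ξ) * Real.exp (((((L ^ r * L ^ kk : ℕ) : ℝ))⁻¹) * (C / ξ)))) ^ (L ^ r) - 1) / ((((L ^ kk : ℕ) : ℝ))⁻¹)))) ^ 2 + (@basisConst ι _ (Matrix mm mm ℂ) Matrix.frobeniusNormedAddCommGroup Matrix.frobeniusNormedSpace e * (2 * Real.sqrt (Fintype.card mm)) * (Real.sqrt (Fintype.card mm) * (((C / ξ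 ^ 2) * Real.exp (((((L ^ r * L ^ kk : ℕ) : ℝ))⁻¹) * (C / ξ))) * (1 + ((((L ^ r * L ^ kk : ℕ) : ℝ))⁻¹) * ((C / ξ) * Real.exp (((((L ^ r * L ^ kk : ℕ) : ℝ))⁻¹) * (C / ξ)))) ^ (L ^ r)))))))) (((1 + (Fintype.card ι * (@basisConst ι _ (Matrix mm mm ℂ) Matrix.frobeniusNormedAddCommGroup Matrix.frobeniusNormedSpace e * (2 * Real.sqrt (Fintype.card mm)) * (Real.sqrt (Fintype.card mm) * (((1 + ((((L ^ r * L ^ kk : ℕ) : ℝ))⁻¹) * ((C / ξ) * Real.exp (((((L ^ r * L ^ kk : ℕ) : ℝ))⁻¹) * (C / ξ)))) ^ (L ^ r) - 1) / ((((L ^ kk : ℕ) : ℝ))⁻¹)))) + Fintype.card ι * (Fintype.card (Fin (d + 1)) * (Fintype.card ι * (@basisConst ι _ (Matrix mm mm ℂ) Matrix.frobeniusNormedAddCommGroup Matrix.frobeniusNormedSpace e * (2 * Real.sqrt (Fintype.card mm)) * (Real.sqrt (Fintype.card mm) * (((1 + ((((L ^ r * L ^ kk : ℕ) : ℝ))⁻¹)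 * ((C / ξ) * Real.exp (((((L ^ r * L ^ kk : ℕ) : ℝ))⁻¹) * (C / ξ)))) ^ (L ^ r) - 1) / ((((L ^ kk : ℕ) : ℝ))⁻¹)))) ^ 2 + (@basisConst ι _ (Matrix mm mm ℂ) Matrix.frobeniusNormedAddCommGroup Matrix.frobeniusNormedSpace e * (2 * Real.sqrt (Fintype.card mm)) * (Real.sqrt (Fintype.card mm) * (((C / ξ ^ 2) * Real.exp (((((L ^ r * L ^ kk : ℕ) : ℝ))⁻¹) * (C / ξ))) * (1 + ((((L ^ r * L ^ kk : ℕ) : ℝ))⁻¹) * ((C / ξ) * Real.exp (((((L ^ r * L ^ kk : ℕ) : ℝ))⁻¹) * (C / ξ)))) ^ (L ^ r))))))) * ((((L ^ kk : ℕ) : ℝ))⁻¹)) ^ ((d + 1) * L ^ kk) - 1)) (((1 + (Fintype.card ι * (@basisConst ι _ (Matrix mm mm ℂ) Matrix.frobeniusNormedAddCommGroup Matrix.frobeniusNormedSpace e * (2 * Real.sqrt (Fintype.card mm)) * (Real.sqrt (Fintype.card mm) * (((1 + ((((L ^ r * L ^ kk : ℕ) : ℝ))⁻¹) * ((C / ξ)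 * Real.exp (((((L ^ r * L ^ kk : ℕ) : ℝ))⁻¹) * (C / ξ)))) ^ (L ^ r) - 1) / ((((L ^ kk : ℕ) : ℝ))⁻¹)))) + Fintype.card ι * (Fintype.card (Fin (d + 1)) * (Fintype.card ι * (@basisConst ι _ (Matrix mm mm ℂ) Matrix.frobeniusNormedAddCommGroup Matrix.frobeniusNormedSpace e * (2 * Real.sqrt (Fintype.card mm)) * (Real.sqrt (Fintype.card mm) * (((1 + ((((L ^ r * L ^ kk : ℕ) : ℝ))⁻¹) * ((C / ξ) * Real.exp (((((L ^ r * L ^ kk : ℕ) : ℝ))⁻¹) * (C / ξ)))) ^ (L ^ r) - 1) / ((((L ^ kk : ℕ) : ℝ))⁻¹)))) ^ 2 + (@basisConst ι _ (Matrix mm mm ℂ) Matrix.frobeniusNormedAddCommGroup Matrix.frobeniusNormedSpace e * (2 * Real.sqrt (Fintype.card mm)) * (Real.sqrt (Fintype.card mm) * (((C / ξ ^ 2) * Real.exp (((((L ^ r * L ^ kk : ℕ) : ℝ))⁻¹) * (C / ξ))) * (1 + ((((L ^ r * L ^ kk : ℕ) : ℝ))⁻¹) * ((C / ξ) * Real.exp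 (((((L ^ r * L ^ kk : ℕ) : ℝ))⁻¹) * (C / ξ)))) ^ (L ^ r))))))) * ((((L ^ r * L ^ kk : ℕ) : ℝ))⁻¹)) ^ ((d + 1) * (L ^ r * L ^ kk)) - 1)) (((1 + (Fintype.card ι * (((((L ^ r * L ^ kk : ℕ) : ℝ))⁻¹) * (@basisConst ι _ (Matrix mm mm ℂ) Matrix.frobeniusNormedAddCommGroup Matrix.frobeniusNormedSpace e * (2 * Real.sqrt (Fintype.card mm)) * (Real.sqrt (Fintype.card mm) * (((1 + ((((L ^ r * L ^ kk : ℕ) : ℝ))⁻¹) * ((C / ξ) * Real.exp (((((L ^ r * L ^ kk : ℕ) : ℝ))⁻¹) * (C / ξ)))) ^ (L ^ r) - 1) / ((((L ^ kk : ℕ) : ℝ))⁻¹))))))) ^ ((d + 1) * (L ^ r - 1)) - 1)) ((((L : ℝ) ^ kk) ^ (-(1 / 4 : ℝ)))) ((((L : ℝ) ^ (2 * kk))⁻¹)) oB a₀ R₀ K₁ K₂ c₀ KI Aη Bc KB D (Real.exp (-(δ / 16 * (unitTorusGeo L kk (cvM d L mv kk hL)).dist y y')))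
    (L ^ r) ((d + 1) * L ^ kk) ((d + 1) * (L ^ r * L ^ kk)) ((d + 1) * (L ^ r - 1))
    hI0 hdd0 (by push_cast; ring) (by simp) (by simp [Fintype.card_sum]; ring) ha₀ hK₁ hK₂ hc₀pos hc₀a hc₀b hKI hAη hBc hKB
    hLk1 hLr1 (by rw [Nat.cast_mul]) (by rw [Nat.cast_sub (Nat.one_le_pow _ _ hLpos), Nat.cast_one]) rfl rfl
    rfl (by push_cast; ring) (by push_cast; ring) (by rw [Nat.cast_mul, Nat.cast_sub (Nat.one_le_pow _ _ hLpos)]; push_cast; ring)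
    (by positivity) (Real.sqrt_nonneg _) (by positivity) (by positivity) hsmall rfl rfl rfl rfl rfl rfl rfl rfl rfl rfl rfl rfl rfl rfl rfl
    (by rw [abs_of_pos (aK_pos ha₀ hL1r hk)]; exact aK_le ha₀ hL1r hk) (abs_aK_sub_aK_le ha₀ hL2r hk r) rfl rfl rfl rfl rfl (by positivity)
    (by rw [Nat.cast_pow]; exact (inv_le_rpow_neg_quarter hx1).1) (by rw [mul_comm, pow_mul]; exact (inv_le_rpow_neg_quarter hx1).2) hoB (Real.exp_pos _)
  obtain ⟨u', hu', hmain⟩ := H1 (key (0 : Tor (cvM d L mv kk hL)) 0).1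
  exact ⟨u', hu', fun hB => (hmain hB).mono fun y y' => (key y y').2⟩

end Small

end Summit.QuantumFields.YangMills.BalabanUVNodes.N15.Gluing

end
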